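import Literature.NumberTheory.Automorphic.UnitaryGroupArthurKernelClassExpansion
import HarnessLib

/-!
# Classes that miss the rational Borel are untruncated: `k^T_𝔬 = K_𝔬` on the diagonal and
# `J^T_𝔬(f)` is independent of `T` — the degenerate (elliptic) case of the `𝔬`-expansion on `U(J_N)`
(Rogawski, *Automorphic Representations of Unitary Groups in Three Variables* (1990), §2.2 p. 13,
§2.3 p. 14; Shokranian, *The Selberg–Arthur Trace Formula*, LNM 1503 (1992), §5.2; after Arthur,
Duke Math. J. 45 (1978), §8 — the classes `𝔬` meeting no proper parabolic)

Topic `NumberTheory/Automorphic`; namespace `Literature.NumberTheory.Automorphic.UnitaryGroup`.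
Proof file: THEOREMS ONLY over the accepted statement layer ★ `UnitaryGroupArthurKernelClassExpansion`
(no definition, no named fact, no instance, no notation, no `sorry`). Setting: the quasi-split unitary
group `U(J_N)` (★ `quasiSplit F E c N`), `B(F) =` ★ `arithmeticBorel`, an ABSTRACT class map
`cl : G(F) → ι` (NO partition axiom is used here), a class `𝔬 = i`, and the class objects
★ `borelSumClass`, ★ `kernelBorelClass` (`K_{B,𝔬}`), ★ `kernelBorelTailClass`, ★ `truncatedKernelClass`
(`k^T_𝔬`), ★ `truncatedTraceClass` (`J^T_𝔬`).

THE POINT. [Rogawski1990, §2.2 p. 13]: `K_{B,𝔬}(x, y) = Σ_{γ ∈ T(F) ∩ 𝔬̲′} ∫_𝐍 f(x⁻¹ γ n y) dn` and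
`k^T_𝔬(x) = K_𝔬(x,x) − Σ_{δ ∈ B\G} K_{B,𝔬}(δx, δx) τ̂_B(H(δx) − T)`. When the class `𝔬̲` contains NO element
of the rational Borel `B(F)` — the hypothesis `hi : ∀ β ∈ B(F), cl β ≠ i` below; for Rogawski's
semisimple classes these are the ELLIPTIC classes, whose terms in the trace formula are orbital
integrals with no truncation [Rogawski1990 §2.3; Arthur 1978 §8] — the Borel sum over `B(F) ∩ 𝔬̲` is
EMPTY, so `K_{B,𝔬} = 0`, the cut-off tail vanishes, **`k^T_𝔬(x) = K_𝔬(x, x)` for every `T`, every Haar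
measure and every fundamental domain**, and `J^T_𝔬(f) = ∫_{G(F)\G(𝔸)} K_𝔬(x, x) dx` does not depend on
`T` (its polynomial in `log T` is a constant). Pure bookkeeping over the statement layer; every `N`.

* §1 `borelSumClass_eq_zero_of_forall_ne`, `kernelBorelClass_eq_zero_of_forall_ne`,
  `kernelBorelTailClass_eq_zero_of_forall_ne` — the class Borel objects vanish.
* §2 **`truncatedKernelClass_eq_kernelClass_of_forall_ne`** — `k^T_𝔬(x) = K_𝔬(x, x)` (all `T`, `ν`, `𝓕`);
  `truncatedKernelClass_eq_of_forall_ne` — independence of `T`, `ν`, `𝓕`.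
* §3 **`truncatedTraceClass_eq_integral_kernelClass_of_forall_ne`** — `J^T_𝔬(f) = ∫ [x] ↦ K_𝔬 dμ`;
  `truncatedTraceClass_eq_of_forall_ne` (independence of `T`, `ν`, `𝓕`);
  `exists_forall_truncatedTraceClass_eq_const_of_forall_ne` (one constant for all `T`, `ν`, `𝓕`);
  `integrable_quotFun_truncatedKernelClass_iff_of_forall_ne` (integrability of `k^T_𝔬` is that of the
  diagonal class kernel, for any `T`).

## References

* J. D. Rogawski, *Automorphic Representations of Unitary Groups in Three Variables*, Annals of
  Mathematics Studies 123 (1990), §2.2 p. 13 (`K_{P,𝔬}`, `k^T_𝔬`, `J^T_𝔬`), §2.3 p. 14 [Rogawski1990].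
* S. Shokranian, *The Selberg–Arthur Trace Formula*, LNM 1503 (1992), §5.2 [Shokranian1992].
* J. Arthur, *A trace formula for reductive groups I*, Duke Math. J. 45 (1978), §8 — cited through the
  held expositions above.
-/

set_option autoImplicit false

noncomputable section

open MeasureTheory Measure NumberField IsDedekindDomain Set
open scoped NNReal ENNReal

namespace Literature.NumberTheory.Automorphic

namespace UnitaryGroup

variable {F E : Type} [Field F] [NumberField F] [Field E] [NumberField E] [Algebra F E]
  {c : E ≃ₐ[F] E} {N : ℕ} {ι : Type*}

/-! ## §1 The class Borel objects of a class missing `B(F)` vanish -/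

/-- **The class Borel sum of a class with no rational Borel representative is EMPTY**:
`Σ_{β ∈ B(F) ∩ 𝔬̲} f(x⁻¹ β z) = 0` when `cl β ≠ i` for all `β ∈ B(F)` (★ `borelSumClass_eq_zero_of_forall`,
vacuously). [cite: Rogawski1990, §2.2 (p. 13)] -/
theorem borelSumClass_eq_zero_of_forall_ne {cl : (quasiSplit F E c N).arithmeticSubgroup → ι} {i : ι}
    (hi : ∀ β : arithmeticBorel F E c N, cl β ≠ i) (f : (quasiSplit F E c N).Adelic → ℂ)
    (x z : (quasiSplit F E c N).Adelic) : borelSumClass cl i f x z = 0 :=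
  borelSumClass_eq_zero_of_forall cl fun β hβ => absurd hβ (hi β)

variable [MeasurableSpace (adelicUnipotent F E c N)]

/-- **`K_{B,𝔬} = 0` for a class missing `B(F)`**: the Borel constant term of the zero class Borel sum
(★ `borelConstantTerm_zero`), for every measure `ν` and every set `𝓕`. [cite: Rogawski1990, §2.2 (p. 13)] -/
theorem kernelBorelClass_eq_zero_of_forall_ne {cl : (quasiSplit F E c N).arithmeticSubgroup → ι} {i : ι}
    (hi : ∀ β : arithmeticBorel F E c N, cl β ≠ i) (ν : Measure (adelicUnipotent F E c N))
    (𝓕 : Set (adelicUnipotent F E c N)) (f : (quasiSplit F E c N).Adelic → ℂ)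
    (x y : (quasiSplit F E c N).Adelic) : kernelBorelClass ν 𝓕 cl i f x y = 0 := by
  rw [kernelBorelClass_def]
  have h : borelSumClass cl i f x = 0 := funext fun z => borelSumClass_eq_zero_of_forall_ne hi f x z
  rw [h, borelConstantTerm_zero]

variable [NeZero N]

/-- **The cut-off class Borel diagonal vanishes for a class missing `B(F)`**: `1_{H > T} K_{B,𝔬}(y, y) = 0`.
[cite: Rogawski1990, §2.2 (p. 13)] -/
theorem kernelBorelTailClass_eq_zero_of_forall_ne {cl : (quasiSplit F E c N).arithmeticSubgroup → ι}
    {i : ι} (hi : ∀ β : arithmeticBorel F E c N, cl β ≠ i) (ν : Measure (adelicUnipotent F E c N))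
    (𝓕 : Set (adelicUnipotent F E c N)) (T : ℝ≥0) (f : (quasiSplit F E c N).Adelic → ℂ) :
    kernelBorelTailClass ν 𝓕 T cl i f = 0 := by
  funext y
  by_cases hy : T < borelHeight y
  · rw [kernelBorelTailClass_of_lt cl i f hy, kernelBorelClass_eq_zero_of_forall_ne hi, Pi.zero_apply]
  · rw [kernelBorelTailClass_of_not_lt cl i f hy, Pi.zero_apply]

/-! ## §2 `k^T_𝔬 = K_𝔬` on the diagonal -/

/-- **A class missing `B(F)` is UNTRUNCATED: `k^T_𝔬(x) = K_𝔬(x, x)`** for every cut-off `T`, every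
measure `ν` and every set `𝓕` — the correction `Σ_δ 1_{H(δx) > T} K_{B,𝔬}(δx, δx)` is a sum of zeros
(★ `pseudoEisenstein_zero`). (Rogawski (1990), §2.3; Arthur (1978), §8: the elliptic classes carry no
truncation.) [cite: Rogawski1990, §2.2 (p. 13)] [cite: Shokranian1992, §5.2] -/
theorem truncatedKernelClass_eq_kernelClass_of_forall_ne {cl : (quasiSplit F E c N).arithmeticSubgroup → ι}
    {i : ι} (hi : ∀ β : arithmeticBorel F E c N, cl β ≠ i) (ν : Measure (adelicUnipotent F E c N))
    (𝓕 : Set (adelicUnipotent F E c N)) (T : ℝ≥0) (f : (quasiSplit F E c N).Adelic → ℂ)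
    (x : (quasiSplit F E c N).Adelic) :
    truncatedKernelClass ν 𝓕 T cl i f x = kernelClass cl i f x x := by
  rw [truncatedKernelClass_def, kernelBorelTailClass_eq_zero_of_forall_ne hi, pseudoEisenstein_zero, sub_zero]

/-- Hence `k^T_𝔬` of a class missing `B(F)` does not depend on `T`, `ν` or `𝓕`.
[cite: Rogawski1990, §2.2 (p. 13)] -/
theorem truncatedKernelClass_eq_of_forall_ne {cl : (quasiSplit F E c N).arithmeticSubgroup → ι} {i : ι}
    (hi : ∀ β : arithmeticBorel F E c N, cl β ≠ i) (ν ν' : Measure (adelicUnipotent F E c N))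
    (𝓕 𝓕' : Set (adelicUnipotent F E c N)) (T T' : ℝ≥0) (f : (quasiSplit F E c N).Adelic → ℂ) :
    truncatedKernelClass ν 𝓕 T cl i f = truncatedKernelClass ν' 𝓕' T' cl i f := by
  funext x
  rw [truncatedKernelClass_eq_kernelClass_of_forall_ne hi, truncatedKernelClass_eq_kernelClass_of_forall_ne hi]

/-! ## §3 `J^T_𝔬(f)` is independent of `T` -/

/-- **`J^T_𝔬(f) = ∫_{G(F)\G(𝔸_F)} K_𝔬(x, x) dx` for a class missing `B(F)`**: the class distribution is the
integral of the (descended) diagonal class kernel, for every `T`, `ν`, `𝓕` and every measure `μ` on the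
automorphic quotient (Rogawski (1990), §2.3: the elliptic terms `J_𝔬(f)`; Arthur (1978), §8).
[cite: Rogawski1990, §2.2 (p. 13)] [cite: Shokranian1992, §5.2] -/
theorem truncatedTraceClass_eq_integral_kernelClass_of_forall_ne
    {cl : (quasiSplit F E c N).arithmeticSubgroup → ι} {i : ι} (hi : ∀ β : arithmeticBorel F E c N, cl β ≠ i)
    (μ : Measure (quasiSplit F E c N).automorphicQuotient) (ν : Measure (adelicUnipotent F E c N))
    (𝓕 : Set (adelicUnipotent F E c N)) (T : ℝ≥0) (f : (quasiSplit F E c N).Adelic → ℂ) :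
    truncatedTraceClass μ ν 𝓕 T cl i f =
      ∫ x, (quasiSplit F E c N).quotFun (fun g => kernelClass cl i f g g) x ∂μ := by
  rw [truncatedTraceClass_def]
  have h : truncatedKernelClass ν 𝓕 T cl i f = fun g => kernelClass cl i f g g :=
    funext fun g => truncatedKernelClass_eq_kernelClass_of_forall_ne hi ν 𝓕 T f g
  rw [h]

/-- Hence `J^T_𝔬(f)` of a class missing `B(F)` does not depend on `T`, `ν` or `𝓕`.
[cite: Rogawski1990, §2.2 (p. 13)] -/
theorem truncatedTraceClass_eq_of_forall_ne {cl : (quasiSplit F E c N).arithmeticSubgroup → ι} {i : ι}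
    (hi : ∀ β : arithmeticBorel F E c N, cl β ≠ i) (μ : Measure (quasiSplit F E c N).automorphicQuotient)
    (ν ν' : Measure (adelicUnipotent F E c N)) (𝓕 𝓕' : Set (adelicUnipotent F E c N)) (T T' : ℝ≥0)
    (f : (quasiSplit F E c N).Adelic → ℂ) :
    truncatedTraceClass μ ν 𝓕 T cl i f = truncatedTraceClass μ ν' 𝓕' T' cl i f := by
  rw [truncatedTraceClass_eq_integral_kernelClass_of_forall_ne hi,
    truncatedTraceClass_eq_integral_kernelClass_of_forall_ne hi]

/-- **`J^T_𝔬(f)` is CONSTANT in `T`** (and in `ν`, `𝓕`) for a class missing `B(F)`: there is `a : ℂ` with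
`J^T_𝔬(f) = a` for all `T`, `ν`, `𝓕` — the degree-`0` case of «`J^T_𝔬(f)` is a polynomial in `log T`»
[Arthur 1981, Prop. 2.3], with `J_𝔬(f) = a`. [cite: Rogawski1990, §2.2 (p. 13)] [cite: Shokranian1992, §5.2] -/
theorem exists_forall_truncatedTraceClass_eq_const_of_forall_ne
    {cl : (quasiSplit F E c N).arithmeticSubgroup → ι} {i : ι} (hi : ∀ β : arithmeticBorel F E c N, cl β ≠ i)
    (μ : Measure (quasiSplit F E c N).automorphicQuotient) (f : (quasiSplit F E c N).Adelic → ℂ) :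
    ∃ a : ℂ, ∀ (ν : Measure (adelicUnipotent F E c N)) (𝓕 : Set (adelicUnipotent F E c N)) (T : ℝ≥0),
      truncatedTraceClass μ ν 𝓕 T cl i f = a :=
  ⟨∫ x, (quasiSplit F E c N).quotFun (fun g => kernelClass cl i f g g) x ∂μ,
    fun ν 𝓕 T => truncatedTraceClass_eq_integral_kernelClass_of_forall_ne hi μ ν 𝓕 T f⟩

/-- For a class missing `B(F)`, the integrability of the descended `k^T_𝔬` on the automorphic quotient is
that of the descended diagonal class kernel `[g] ↦ K_𝔬(g⁻¹, g⁻¹)`, for any `T`, `ν`, `𝓕` (so the per-class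
integrability theorem at ONE large `T` gives it at every `T`). [cite: Rogawski1990, §2.2 (p. 13)] -/
theorem integrable_quotFun_truncatedKernelClass_iff_of_forall_ne
    {cl : (quasiSplit F E c N).arithmeticSubgroup → ι} {i : ι} (hi : ∀ β : arithmeticBorel F E c N, cl β ≠ i)
    (μ : Measure (quasiSplit F E c N).automorphicQuotient) (ν : Measure (adelicUnipotent F E c N))
    (𝓕 : Set (adelicUnipotent F E c N)) (T : ℝ≥0) (f : (quasiSplit F E c N).Adelic → ℂ) :
    Integrable ((quasiSplit F E c N).quotFun (truncatedKernelClass ν 𝓕 T cl i f)) μ ↔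
      Integrable ((quasiSplit F E c N).quotFun (fun g => kernelClass cl i f g g)) μ := by
  have h : truncatedKernelClass ν 𝓕 T cl i f = fun g => kernelClass cl i f g g :=
    funext fun g => truncatedKernelClass_eq_kernelClass_of_forall_ne hi ν 𝓕 T f g
  rw [h]

end UnitaryGroup

end Literature.NumberTheory.Automorphic

end
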